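import Literature.MathematicalPhysics.QuantumManyBody.PeriodicBoseGasJastrow
import Literature.MathematicalPhysics.QuantumManyBody.PeriodicBoseGasScattering
import HarnessLib

/-!
# LSSY Theorem 2.2 (2.14): the discharge of `LSSY2005_upperBound_periodic`

Topic `Literature/MathematicalPhysics/QuantumManyBody`, sibling of `PeriodicBoseGas.lean`
(provefact `Literature.MathematicalPhysics.QuantumManyBody.BoseGas.LSSY2005_upperBound_periodic`). The Dyson–Lieb–Seiringer–Yngvason
upper bound `E₀^per(N,L)/N ≤ 4πρ₁a(1 + C a/b)` [LSSY2005, Thm. 2.2 (2.14)], as vendored in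
`PeriodicBoseGas.lean`, follows from its three layers (`PeriodicBoseGasUpperBound.lean`:
`LSSY2005_upperBound_periodic_of_layers`), all of which are proved:
the two-body profile (`PeriodicBoseGasScattering.lean`: `LSSY2005_dysonProfile_holds`,
`LSSY2005_zeroScatteringLength_holds`) and the product trial state
(`PeriodicBoseGasJastrow.lean`: `LSSY2005_jastrowBound_holds`).

## References

* [LSSY2005] E. H. Lieb, R. Seiringer, J. P. Solovej, J. Yngvason, *The Mathematics of the Bose
  Gas and its Condensation*, Oberwolfach Seminars 34, Birkhäuser 2005, arXiv:cond-mat/0610117: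
  Thm. 2.2 (2.14), pp. 12–13; App. C.
-/

namespace Literature.MathematicalPhysics.QuantumManyBody.BoseGas

/-- **LSSY 2005, Theorem 2.2 (2.14), proved**: the named fact `LSSY2005_upperBound_periodic`
(`E₀^per(N,L) ≤ 4πρ₁a(1 + C a/b) N` for finite-range `v ≥ 0`, `2R₀ < L`, `a/b ≤ c`) holds, with
`C = 12` and `c = c(v)`. [cite: LSSY2005, Thm. 2.2 (2.14)] -/
theorem LSSY2005_upperBound_periodic_holds : LSSY2005_upperBound_periodic :=
  LSSY2005_upperBound_periodic_of_layers LSSY2005_dysonProfile_holds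
    LSSY2005_zeroScatteringLength_holds LSSY2005_jastrowBound_holds

end Literature.MathematicalPhysics.QuantumManyBody.BoseGas
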